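import Mathlib
import Summits.Ventures.HodgeRepro.Tier4.Line4.TailPieces
import Summits.Ventures.HodgeRepro.Tier4.Line4.UnitBeta
import Summits.Ventures.HodgeRepro.Tier4.Line4.CentreFinSeesaw
import Summits.Ventures.HodgeRepro.Tier4.Line4.SeesawDistribution
import Summits.Ventures.HodgeRepro.Tier4.Line1.DefinedContentOfData

/-!
# Tier4/Line4/TailSeesaw — C-L4-7B-ASSEMBLY: the (7b) display `TailForArch'''` at the SEESAW INSTANCE from the pieces,
every plane fact by name; the residual binders are the (7b) census of record

Blind re-derivation cell `pub-hodge-repro`, Tier 4 «prove the step» (README §9–§10), seat t4-L2-p2 (gen 5; plan-4 g6's cut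
S15841 «C-L4-7B-ASSEMBLY», TAKEN S15854; on x2 g5's generic layer `exists_levelFamily_fibreDominated_of_pieces`
(TailPieces, S15867)).  Tree path `lean/Summits/Ventures/HodgeRepro/Tier4/Line4/TailSeesaw.lean`.  Imports x2's
`Line4/TailPieces`, this seat's `Line4/UnitBeta` (`unit_beta_of_ne_zero`, `suppMeasure_toReal_pos_of_beta`), this seat's
`Line4/CentreFinSeesaw` (`centreFinFinite_of_compactSpace_torusInf`), L4-p2's `Line4/SeesawDistribution`
(`isGenuineRow_seesawPlane`) and L1-p3's `Line1/DefinedContentOfData` (`isRegularRational_of_isLinRegular`).  Mathlib-level;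
no literature; no `def`.

LAYERS.  **`tailForArch_body_of_pieces`** (any plane `W` with `hdet`, `hgen`, `hlin`, compact archimedean tori): the body of
`TailForArch'''` from x2's generic theorem with, BY NAME, `hreg` (`isRegularRational_of_isLinRegular`), the finiteness of the
archimedean Haar pair (`CompactSpace.isFiniteMeasure`), the CM input (`centreFinFinite_of_compactSpace_torusInf`), the unit
`hβ` at the currency `νf ((Z_f ∩ levelTf 1) · levelTf (p^M))` (`unit_beta_of_ne_zero`, `M₄ := #(centreFin W ⊓ levelTfSub W 1)`)
and its positivity `hv` (`suppMeasure_toReal_pos_of_beta`, `hfin` from `suppMeasure_ne_top` + PROPER).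
**`tailForArch_seesaw_of_pieces`** (the plane of record `(mixedRow q (a 0) (a 2)).withTransportedTorus g g' hgg' hg'g hgΩ`
= `seesawPlane …` by `rfl`): the same with `hgen` by name (`isGenuineRow_seesawPlane`: `ht : q.t = 0`, `hn : ¬ IsSquare (−q.n)`,
the (7b) binders `_ha`, `lam`, `_hlam`, `_hiso`).  **`exists_pieces_of_threshold`** + **`tailForArch_seesaw_of_pieces_threshold`**:
the (F) pieces taken in their THRESHOLD form (crit-2 g10's R1, S15873) — the finitely many levels below `c₀` patched.

THE RESIDUAL (the (7b) census at this layer — every binder below that is NOT a binder of the display `l4_tailForArch`):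
`ht`, `hn` (v0.43's normalisation); `hdet : W.B.det ≠ 0` (L1-p2's `det_ofLinesRow_B_ne_zero` at its landing); the Haar
normalisations `νf νf' c c' hcμ hcμ' μinf μ₀ c₀ hcμ₀` (EXIST by name: `exists_smul_map_prod_eq` / `'` / `_ga` — data); the
`Z(k)`-domain `DZf hDZf hfd hDZc` (EXISTS by name: AwayDomain's `exists_isFundamentalDomain_prod_univ_of_compactSpace_at` under
L1-p2's `hdisc`/`hTS`, or CentreFinDomain's `exists_isFundamentalDomain_centreFin` under `hZc`); the level prime `p hp hγ₀`
(`exists_levelPrime`, chosen jointly with `γ₀`); the (F) pieces `u κ hκ hproj` ((F-c), L1-p1) and `M₃ hM₃ hcur` (L1-p4's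
CurrencyMatch, at THIS currency) — in threshold form from `c₀`; (S-COUNT) `hcount` (⇐ `ArchBallGrowth`); (S-FIN-NV) `hnv`
(L4-x2's FinNVGlue); and, PER ARCHIMEDEAN COEFFICIENT `finf` (`hdisp`): an archimedean test `e` (`IsInfFactor`,
`T′_∞`-equivariance, `harch` — C-L4-ARCHAPPROX), a sparsity scale `gth` with (S-SPARSE) `hR` (L1-p3's HRWrapper chain) and the
chain inputs `hchain` (L2-p3's `chainInputs_of_pieces`).

Nothing here says anything about the status of the Hodge conjecture for CM abelian varieties, which is NOT proved
(HC_CM is NOT proved by anyone in this repository).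
-/

set_option autoImplicit false

noncomputable section

namespace Summit.Ventures.HodgeRepro.Tier4.Line4

open Matrix MeasureTheory Topology Filter NumberField IsDedekindDomain Summit.Ventures.HodgeRepro.Tier4
  Summit.Ventures.HodgeRepro.Tier4.Common Summit.Ventures.HodgeRepro.Tier4.Line1
  Summit.Ventures.HodgeRepro.Tier4.Line1.RTF Summit.Ventures.HodgeRepro.Tier4.Line4.L1Class

open scoped NumberField NNReal ENNReal Pointwise Matrix

section Body

variable {k : Type} [Field k] [NumberField k] (W : PlaneData k) [MeasurableSpace (GA W)] [BorelSpace (GA W)]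
  (R : RTFData W) (μ : Measure (GA W)) [μ.IsHaarMeasure] [R.μT.IsHaarMeasure] [R.μT'.IsHaarMeasure]
  (DG : Set (GA W)) (fdG : IsFundamentalDomain (rationalPoints W) DG μ) (compG : IsCompact (closure DG))
  (compT : IsCompact (closure R.DT)) (compT' : IsCompact (closure R.DT'))

/-- **The body of `TailForArch'''` on any genuine plane with compact archimedean tori**, from x2's generic layer with the
regularity, the finiteness of the archimedean Haar pair, the CM input, the unit `hβ` and its positivity `hv` discharged BY
NAME; the residual binders are listed in the module docstring. -/
theorem tailForArch_body_of_pieces [MeasurableMul (torusT W)] [MeasurableMul (torusT' W)]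
    (hRH : R.IsHaar)
    (hc : Continuous R.chi) (hu : ∀ a, ‖R.chi a‖ = 1) (hc' : Continuous R.chi') (hu' : ∀ a, ‖R.chi' a‖ = 1)
    (q : QuadData k) (g g' : Matrix (Fin 4) (Fin 4) k) (w₀ : InfinitePlace k) (eP eM eP' eM' : InfinitePlace k → ℤ)
    (hdet : W.B.det ≠ 0) (hgen : IsGenuineRow W)
    (γ₀ : rationalPoints W) (hlin : IsLinRegular W γ₀)
    (νinf : Measure (torusInf W)) [νinf.IsHaarMeasure] [CompactSpace (torusInf W)]
    (νf : Measure (torusFin W)) [νf.IsHaarMeasure]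
    (c : ℝ≥0) (hc0 : 0 < c) (hcμ : R.μT = c • Measure.map (torusSplit W).symm (νinf.prod νf))
    (νinf' : Measure (torusInf' W)) [νinf'.IsHaarMeasure] [CompactSpace (torusInf' W)]
    (νf' : Measure (torusFin' W)) [νf'.IsHaarMeasure]
    (c' : ℝ≥0) (hc0' : 0 < c') (hcμ' : R.μT' = c' • Measure.map (torusSplit' W).symm (νinf'.prod νf'))
    (DZf : Set (torusFin W)) (hDZf : MeasurableSet DZf) (hfd : IsFundamentalDomain (centreFin W) DZf νf)
    (hDZc : ∀ C : Set (torusFin W), IsCompact C → IsCompact (closure (DZf ∩ (C * (ZfIn W : Set (torusFin W))))))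
    (μinf : Measure (infinitePart W)) [μinf.IsHaarMeasure] (μ₀ : Measure (finitePart W)) [μ₀.IsHaarMeasure]
    (c₀ : ℝ≥0) (hc₀ : 0 < c₀) (hcμ₀ : μ = c₀ • Measure.map (gaSplit W).symm (μinf.prod μ₀))
    (p : ℕ) (hp : p.Prime)
    (hγ₀ : ∀ v : HeightOneSpectrum (𝓞 k), natSize k v p < 1 → ∀ i j : Fin 4,
      Valued.v (finPart k (GA.mat W (γ₀ : GA W) i j) v) ≤ 1 ∧ Valued.v (finPart k (GA.mat W (γ₀ : GA W)⁻¹ i j) v) ≤ 1)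
    -- the (F) pieces at the currency of record
    (u : ℕ → ℝ≥0∞) (κ : ℝ≥0∞) (hκ : κ ≠ ⊤)
    (hproj : ∀ (M : ℕ) (γ : GA W), νf (finTf W '' closure R.DT ∩ projSet W (γ₀ : GA W) (p ^ M) γ) ≤ κ * u M)
    (M₃ : ℝ≥0∞) (hM₃ : M₃ ≠ ⊤)
    (hcur : ∀ M, u M ≤ M₃ * νf (((ZfIn W : Set (torusFin W)) ∩ levelTf W 1) * levelTf W (p ^ M)))
    -- (S-COUNT), (S-FIN-NV)
    (hcount : SublevelCount₀ W (Setting.ofAdelicData W R μ DG fdG compG compT compT'))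
    (hnv : ∃ δ : ℝ, 0 < δ ∧ ∃ M₀ : ℕ, ∀ M ≥ M₀,
      δ * (suppMeasure W νf νf' (γ₀ : GA W) DZf (p ^ M) (γ₀ : GA W)).toReal ≤
        ‖∫ b in DZf, R.chi b * innerFin W R (levelDC W (γ₀ : GA W) (p ^ M)) (γ₀ : GA W) νf' b ∂νf‖)
    -- per archimedean coefficient: the archimedean test, `harch`, (S-SPARSE), `ChainInputs`
    (hdisp : ∀ finf : GA W → ℂ,
      IsArchCoeffD W (Setting.ofAdelicData W R μ DG fdG compG compT compT') R q g g' w₀ eP eM eP' eM'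
        (γ₀ : GA W) νinf νinf' finf →
      ∃ e : GA W → ℂ, IsInfFactor W e ∧
        (∀ (w : InfinitePlace k) (κ : GA W), κ ∈ localTorusAt' W w → ∀ x,
          e (x * κ) = weightAt' W q w g g' 0 κ ^ (-eP' w) * weightAt' W q w g g' 1 κ ^ (-eM' w) * e x) ∧
        L1Class.archFactor W R (convInf W μinf finf e) (γ₀ : GA W) νinf νinf' ≠ 0 ∧
        (∃ gth : ℕ → ℝ, Tendsto gth atTop atTop ∧
          ∀ (M : ℕ) (γ : (Setting.ofAdelicData W R μ DG fdG compG compT compT').Gk),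
            (Setting.ofAdelicData W R μ DG fdG compG compT compT').orbitOf γ ∉
              ({(Setting.ofAdelicData W R μ DG fdG compG compT compT').orbitOf γ₀} :
                Finset (Setting.ofAdelicData W R μ DG fdG compG compT compT').Orbit) →
            (∃ t ∈ R.DT, ∃ t' ∈ R.DT',
              (Setting.ofAdelicData W R μ DG fdG compG compT compT').conv
                (prodFn W finf (ffinMu W μ₀ (γ₀ : GA W) (p ^ M))) (testNat W e (p ^ M))
                ((t : GA W)⁻¹ * γ * (t' : GA W)) ≠ 0) →
            gth (p ^ M) ≤ archDist W (γ : GA W)) ∧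
        ∀ M : ℕ, ChainInputs W R γ₀ νinf νf νinf' νf' DZf
          ((Setting.ofAdelicData W R μ DG fdG compG compT compT').conv
            (prodFn W finf (ffinMu W μ₀ (γ₀ : GA W) (p ^ M))) (testNat W e (p ^ M)))
          (fun x => (c₀ : ℂ) * convInf W μinf finf e x) (levelDC W (γ₀ : GA W) (p ^ M))) :
    ∀ finf : GA W → ℂ,
      IsArchCoeffD W (Setting.ofAdelicData W R μ DG fdG compG compT compT') R q g g' w₀ eP eM eP' eM'
        (γ₀ : GA W) νinf νinf' finf →
      ∃ lev : ℕ → ℕ, (∀ n, lev n ≠ 0) ∧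
      ∃ ffin f₂ : ℕ → GA W → ℂ, TailFamily' W q g g' eP' eM' (γ₀ : GA W) ffin f₂ ∧
        ∃ E : Finset (Setting.ofAdelicData W R μ DG fdG compG compT compT').Orbit,
          (Setting.ofAdelicData W R μ DG fdG compG compT compT').orbitOf γ₀ ∈ E ∧
          FibreDominatedFrom (Setting.ofAdelicData W R μ DG fdG compG compT compT') R.chi R.chi' E
            (fun n => (Setting.ofAdelicData W R μ DG fdG compG compT compT').conv
              (prodFn W finf (ffin (lev n))) (f₂ (lev n))) := by
  intro finf hfinf
  obtain ⟨e, he, hequiv, harch, ⟨gth, hg, hR⟩, hchain⟩ := hdisp finf hfinf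
  -- the plane facts by name
  have hreg : IsRegularRational W γ₀ := isRegularRational_of_isLinRegular W γ₀ hlin
  have hZ : CentreFinFinite W := centreFinFinite_of_compactSpace_torusInf W
  have hprop : HasProperFinOrbit W (γ₀ : GA W) := hasProperFinOrbit_of_isLinRegular W hdet hgen γ₀ hlin
  have hpM : ∀ M : ℕ, p ^ M ≠ 0 := fun M => pow_ne_zero _ hp.ne_zero
  have hfin : ∀ M : ℕ, suppMeasure W νf νf' (γ₀ : GA W) DZf (p ^ M) (γ₀ : GA W) ≠ ⊤ := fun M =>
    suppMeasure_ne_top W νf νf' (γ₀ : GA W) DZf hDZc (hpM M) hprop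
  -- the unit `hβ` and its positivity `hv`, by name
  have hβ : ∀ M : ℕ, νf (((ZfIn W : Set (torusFin W)) ∩ levelTf W 1) * levelTf W (p ^ M)) * νf' (levelTf' W (p ^ M)) ≤
      (Nat.card (centreFin W ⊓ levelTfSub W 1 : Subgroup (torusFin W)) : ℝ≥0∞) *
        suppMeasure W νf νf' (γ₀ : GA W) DZf (p ^ M) (γ₀ : GA W) := fun M =>
    unit_beta_of_ne_zero W νf νf' (γ₀ : GA W) DZf hDZf hfd hZ (p ^ M) (hpM M)
  have hv : ∀ M : ℕ, 0 < (suppMeasure W νf νf' (γ₀ : GA W) DZf (p ^ M) (γ₀ : GA W)).toReal := fun M =>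
    suppMeasure_toReal_pos_of_beta W νf νf' (γ₀ : GA W) DZf hDZf hfd hZ (hpM M) (hfin M)
  exact exists_levelFamily_fibreDominated_of_pieces W R μ DG fdG compG compT compT' hRH hc hu hc' hu' q g g' w₀
    eP eM eP' eM' hdet hgen γ₀ hreg hlin νinf νf c hc0 hcμ νinf' νf' c' hc0' hcμ' DZf hDZf hfd hDZc μinf μ₀ c₀ hc₀
    hcμ₀ finf hfinf he hequiv harch p hp hγ₀ u κ hκ hproj
    (fun M => νf (((ZfIn W : Set (torusFin W)) ∩ levelTf W 1) * levelTf W (p ^ M))) M₃ hM₃ hcur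
    (Nat.card (centreFin W ⊓ levelTfSub W 1 : Subgroup (torusFin W)) : ℝ≥0∞) (ENNReal.natCast_ne_top _) hβ hv
    hcount gth hg hR hnv hchain

end Body


section Threshold

variable {k : Type} [Field k] [NumberField k] (W : PlaneData k) [MeasurableSpace (GA W)] [BorelSpace (GA W)]
  (R : RTFData W)

omit [BorelSpace (GA W)] in
/-- **The (F) pieces from their THRESHOLD form** (crit-2 g10's R1, S15873): (F-c) and the currency match are green only
from a level `c₀` on (`q^(n+c₀+1)`, RatioAssembly's `∃ c₀`); the finitely many levels `M < c₀` are patched by the trivial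
bound `νf (C ∩ projSet γ) ≤ νf C` (`C := finTf '' closure D_T` compact, `νf C < ⊤`) with `u' M := νf C`, and the currency
match there by `νf C ≤ (νf C / v M) · v M` (`v M > 0` as the measure of an open set `∋ 1`; `M₃' := M₃ + 1 + Σ_{M < c₀} νf C / v M`
finite).  So the generic layer's all-level binders `hproj` / `hcur` follow from the threshold forms. -/
theorem exists_pieces_of_threshold (compT : IsCompact (closure R.DT)) (νf : Measure (torusFin W)) [νf.IsHaarMeasure]
    (γ₀ : GA W) (p : ℕ) (hp : p ≠ 0) (c₀ : ℕ) (u : ℕ → ℝ≥0∞) (κ : ℝ≥0∞) (hκ : κ ≠ ⊤)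
    (hproj : ∀ M, c₀ ≤ M → ∀ γ : GA W, νf (finTf W '' closure R.DT ∩ projSet W γ₀ (p ^ M) γ) ≤ κ * u M)
    (M₃ : ℝ≥0∞) (hM₃ : M₃ ≠ ⊤)
    (hcur : ∀ M, c₀ ≤ M → u M ≤ M₃ * νf (((ZfIn W : Set (torusFin W)) ∩ levelTf W 1) * levelTf W (p ^ M))) :
    ∃ (u' : ℕ → ℝ≥0∞) (κ' M₃' : ℝ≥0∞), κ' ≠ ⊤ ∧ M₃' ≠ ⊤ ∧
      (∀ (M : ℕ) (γ : GA W), νf (finTf W '' closure R.DT ∩ projSet W γ₀ (p ^ M) γ) ≤ κ' * u' M) ∧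
      ∀ M, u' M ≤ M₃' * νf (((ZfIn W : Set (torusFin W)) ∩ levelTf W 1) * levelTf W (p ^ M)) := by
  have hCc : IsCompact (finTf W '' closure R.DT) := compT.image (continuous_finTf W)
  have hCm : νf (finTf W '' closure R.DT) ≠ ⊤ := hCc.measure_lt_top.ne
  -- the currency is positive at every level
  have hv0 : ∀ M : ℕ, νf (((ZfIn W : Set (torusFin W)) ∩ levelTf W 1) * levelTf W (p ^ M)) ≠ 0 := by
    intro M
    have hsub : levelTf W (p ^ M) ⊆ ((ZfIn W : Set (torusFin W)) ∩ levelTf W 1) * levelTf W (p ^ M) := fun l hl =>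
      ⟨1, ⟨one_mem _, one_mem_levelTf W 1⟩, l, hl, one_mul l⟩
    exact (lt_of_lt_of_le ((isOpen_levelTf W (pow_ne_zero _ hp)).measure_pos νf ⟨1, one_mem_levelTf W _⟩)
      (measure_mono hsub)).ne'
  -- the patched constants
  have hone : 1 ≤ M₃ + 1 + ∑ M ∈ Finset.range c₀,
      νf (finTf W '' closure R.DT) / νf (((ZfIn W : Set (torusFin W)) ∩ levelTf W 1) * levelTf W (p ^ M)) :=
    le_trans le_add_self le_self_add
  refine ⟨fun M => if M < c₀ then νf (finTf W '' closure R.DT) else u M, max κ 1,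
    M₃ + 1 + ∑ M ∈ Finset.range c₀,
      νf (finTf W '' closure R.DT) / νf (((ZfIn W : Set (torusFin W)) ∩ levelTf W 1) * levelTf W (p ^ M)),
    (max_lt hκ.lt_top ENNReal.one_lt_top).ne, ?_, ?_, ?_⟩
  · refine ENNReal.add_ne_top.2 ⟨ENNReal.add_ne_top.2 ⟨hM₃, ENNReal.one_ne_top⟩, ?_⟩
    exact ENNReal.sum_ne_top.2 fun M _ => ENNReal.div_ne_top hCm (hv0 M)
  · intro M γ
    by_cases hM : M < c₀
    · simp only [if_pos hM]
      exact (measure_mono Set.inter_subset_left).trans (le_mul_of_one_le_left zero_le (le_max_right _ _))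
    · simp only [if_neg hM]
      exact (hproj M (not_lt.1 hM) γ).trans (mul_le_mul' (le_max_left _ _) le_rfl)
  · intro M
    by_cases hM : M < c₀
    · simp only [if_pos hM]
      by_cases hvt : νf (((ZfIn W : Set (torusFin W)) ∩ levelTf W 1) * levelTf W (p ^ M)) = ⊤
      · rw [hvt, ENNReal.mul_top (lt_of_lt_of_le zero_lt_one hone).ne']
        exact le_top
      · have h1 : νf (finTf W '' closure R.DT) ≤
            νf (finTf W '' closure R.DT) / νf (((ZfIn W : Set (torusFin W)) ∩ levelTf W 1) * levelTf W (p ^ M)) *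
              νf (((ZfIn W : Set (torusFin W)) ∩ levelTf W 1) * levelTf W (p ^ M)) :=
          (ENNReal.div_le_iff (hv0 M) hvt).1 le_rfl
        refine h1.trans (mul_le_mul' ?_ le_rfl)
        have hsingle : νf (finTf W '' closure R.DT) /
            νf (((ZfIn W : Set (torusFin W)) ∩ levelTf W 1) * levelTf W (p ^ M)) ≤
            ∑ M ∈ Finset.range c₀, νf (finTf W '' closure R.DT) /
              νf (((ZfIn W : Set (torusFin W)) ∩ levelTf W 1) * levelTf W (p ^ M)) :=
          Finset.single_le_sum (f := fun M => νf (finTf W '' closure R.DT) /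
            νf (((ZfIn W : Set (torusFin W)) ∩ levelTf W 1) * levelTf W (p ^ M))) (fun _ _ => zero_le)
            (Finset.mem_range.2 hM)
        exact le_trans hsingle le_add_self
    · simp only [if_neg hM]
      exact (hcur M (not_lt.1 hM)).trans (mul_le_mul' (le_trans le_self_add le_self_add) le_rfl)

end Threshold

section Seesaw

variable {k : Type} [Field k] [NumberField k]

/-- **C-L4-7B-ASSEMBLY — the (7b) display at the plane of record** `(mixedRow q (a 0) (a 2)).withTransportedTorus g g' hgg'
hg'g hgΩ` (= `seesawPlane …` by `rfl`): `tailForArch_body_of_pieces` with the genuine-row fact by name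
(`isGenuineRow_seesawPlane`, under the normalisation `ht : q.t = 0`, `hn : ¬ IsSquare (−q.n)` and the display's own
`_ha`, `lam`, `_hlam`, `_hiso`).  The residual binders = the module docstring's census. -/
theorem tailForArch_seesaw_of_pieces (q : QuadData k) (ht : q.t = 0) (hn : ¬ IsSquare (-q.n))
    (a : Fin 4 → k) (ha : ∀ i, a i ≠ 0)
    (g g' : Matrix (Fin 4) (Fin 4) k) (hgg' : g * g' = 1) (hg'g : g' * g = 1)
    (hgΩ : g * (PlaneData.mixedRow q (a 0) (a 2)).Ω = (PlaneData.mixedRow q (a 0) (a 2)).Ω * g)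
    (lam : k) (hlam : lam ≠ 0)
    (hiso : g * (PlaneData.mixedRow q (a 1) (a 3)).B * gᵀ = lam • (PlaneData.mixedRow q (a 0) (a 2)).B)
    (hdet : ((PlaneData.mixedRow q (a 0) (a 2)).withTransportedTorus g g' hgg' hg'g hgΩ).B.det ≠ 0)
    [MeasurableSpace (GA ((PlaneData.mixedRow q (a 0) (a 2)).withTransportedTorus g g' hgg' hg'g hgΩ))]
    [BorelSpace (GA ((PlaneData.mixedRow q (a 0) (a 2)).withTransportedTorus g g' hgg' hg'g hgΩ))]
    [MeasurableMul (torusT ((PlaneData.mixedRow q (a 0) (a 2)).withTransportedTorus g g' hgg' hg'g hgΩ))]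
    [MeasurableMul (torusT' ((PlaneData.mixedRow q (a 0) (a 2)).withTransportedTorus g g' hgg' hg'g hgΩ))]
    (R : RTFData ((PlaneData.mixedRow q (a 0) (a 2)).withTransportedTorus g g' hgg' hg'g hgΩ)) (hRH : R.IsHaar)
    (hc : Continuous R.chi) (hu : ∀ a, ‖R.chi a‖ = 1) (hc' : Continuous R.chi') (hu' : ∀ a, ‖R.chi' a‖ = 1)
    (w₀ : InfinitePlace k) (eP eM eP' eM' : InfinitePlace k → ℤ)
    [R.μT.IsHaarMeasure] [R.μT'.IsHaarMeasure]
    (μ : Measure (GA ((PlaneData.mixedRow q (a 0) (a 2)).withTransportedTorus g g' hgg' hg'g hgΩ))) [μ.IsHaarMeasure]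
    (DG : Set (GA ((PlaneData.mixedRow q (a 0) (a 2)).withTransportedTorus g g' hgg' hg'g hgΩ)))
    (fdG : IsFundamentalDomain (rationalPoints ((PlaneData.mixedRow q (a 0) (a 2)).withTransportedTorus g g' hgg' hg'g hgΩ)) DG μ)
    (compG : IsCompact (closure DG)) (compT : IsCompact (closure R.DT)) (compT' : IsCompact (closure R.DT'))
    (γ₀ : rationalPoints ((PlaneData.mixedRow q (a 0) (a 2)).withTransportedTorus g g' hgg' hg'g hgΩ))
    (hlin : IsLinRegular ((PlaneData.mixedRow q (a 0) (a 2)).withTransportedTorus g g' hgg' hg'g hgΩ) γ₀)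
    (νinf : Measure (torusInf ((PlaneData.mixedRow q (a 0) (a 2)).withTransportedTorus g g' hgg' hg'g hgΩ)))
    [νinf.IsHaarMeasure] [CompactSpace (torusInf ((PlaneData.mixedRow q (a 0) (a 2)).withTransportedTorus g g' hgg' hg'g hgΩ))]
    (νf : Measure (torusFin ((PlaneData.mixedRow q (a 0) (a 2)).withTransportedTorus g g' hgg' hg'g hgΩ))) [νf.IsHaarMeasure]
    (c : ℝ≥0) (hc0 : 0 < c)
    (hcμ : R.μT = c • Measure.map (torusSplit ((PlaneData.mixedRow q (a 0) (a 2)).withTransportedTorus g g' hgg' hg'g hgΩ)).symm (νinf.prod νf))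
    (νinf' : Measure (torusInf' ((PlaneData.mixedRow q (a 0) (a 2)).withTransportedTorus g g' hgg' hg'g hgΩ)))
    [νinf'.IsHaarMeasure] [CompactSpace (torusInf' ((PlaneData.mixedRow q (a 0) (a 2)).withTransportedTorus g g' hgg' hg'g hgΩ))]
    (νf' : Measure (torusFin' ((PlaneData.mixedRow q (a 0) (a 2)).withTransportedTorus g g' hgg' hg'g hgΩ))) [νf'.IsHaarMeasure]
    (c' : ℝ≥0) (hc0' : 0 < c')
    (hcμ' : R.μT' = c' • Measure.map (torusSplit' ((PlaneData.mixedRow q (a 0) (a 2)).withTransportedTorus g g' hgg' hg'g hgΩ)).symm (νinf'.prod νf'))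
    (DZf : Set (torusFin ((PlaneData.mixedRow q (a 0) (a 2)).withTransportedTorus g g' hgg' hg'g hgΩ))) (hDZf : MeasurableSet DZf)
    (hfd : IsFundamentalDomain (centreFin ((PlaneData.mixedRow q (a 0) (a 2)).withTransportedTorus g g' hgg' hg'g hgΩ)) DZf νf)
    (hDZc : ∀ C : Set (torusFin ((PlaneData.mixedRow q (a 0) (a 2)).withTransportedTorus g g' hgg' hg'g hgΩ)), IsCompact C →
      IsCompact (closure (DZf ∩ (C * (ZfIn ((PlaneData.mixedRow q (a 0) (a 2)).withTransportedTorus g g' hgg' hg'g hgΩ) : Set _)))))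
    (μinf : Measure (infinitePart ((PlaneData.mixedRow q (a 0) (a 2)).withTransportedTorus g g' hgg' hg'g hgΩ))) [μinf.IsHaarMeasure]
    (μ₀ : Measure (finitePart ((PlaneData.mixedRow q (a 0) (a 2)).withTransportedTorus g g' hgg' hg'g hgΩ))) [μ₀.IsHaarMeasure]
    (c₀ : ℝ≥0) (hc₀ : 0 < c₀)
    (hcμ₀ : μ = c₀ • Measure.map (gaSplit ((PlaneData.mixedRow q (a 0) (a 2)).withTransportedTorus g g' hgg' hg'g hgΩ)).symm (μinf.prod μ₀))
    (p : ℕ) (hp : p.Prime)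
    (hγ₀ : ∀ v : HeightOneSpectrum (𝓞 k), natSize k v p < 1 → ∀ i j : Fin 4,
      Valued.v (finPart k (GA.mat _ (γ₀ : GA ((PlaneData.mixedRow q (a 0) (a 2)).withTransportedTorus g g' hgg' hg'g hgΩ)) i j) v) ≤ 1 ∧ Valued.v (finPart k (GA.mat _ (γ₀ : GA ((PlaneData.mixedRow q (a 0) (a 2)).withTransportedTorus g g' hgg' hg'g hgΩ))⁻¹ i j) v) ≤ 1)
    (u : ℕ → ℝ≥0∞) (κ : ℝ≥0∞) (hκ : κ ≠ ⊤)
    (hproj : ∀ (M : ℕ) (γ : GA ((PlaneData.mixedRow q (a 0) (a 2)).withTransportedTorus g g' hgg' hg'g hgΩ)),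
      νf (finTf _ '' closure R.DT ∩ projSet _ (γ₀ : GA ((PlaneData.mixedRow q (a 0) (a 2)).withTransportedTorus g g' hgg' hg'g hgΩ)) (p ^ M) γ) ≤ κ * u M)
    (M₃ : ℝ≥0∞) (hM₃ : M₃ ≠ ⊤)
    (hcur : ∀ M, u M ≤ M₃ * νf (((ZfIn ((PlaneData.mixedRow q (a 0) (a 2)).withTransportedTorus g g' hgg' hg'g hgΩ) : Set (torusFin ((PlaneData.mixedRow q (a 0) (a 2)).withTransportedTorus g g' hgg' hg'g hgΩ))) ∩ levelTf _ 1) * levelTf _ (p ^ M)))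
    (hcount : SublevelCount₀ _ (Setting.ofAdelicData _ R μ DG fdG compG compT compT'))
    (hnv : ∃ δ : ℝ, 0 < δ ∧ ∃ M₀ : ℕ, ∀ M ≥ M₀,
      δ * (suppMeasure _ νf νf' (γ₀ : GA ((PlaneData.mixedRow q (a 0) (a 2)).withTransportedTorus g g' hgg' hg'g hgΩ)) DZf (p ^ M) (γ₀ : GA ((PlaneData.mixedRow q (a 0) (a 2)).withTransportedTorus g g' hgg' hg'g hgΩ))).toReal ≤
        ‖∫ b in DZf, R.chi b * innerFin _ R (levelDC _ (γ₀ : GA ((PlaneData.mixedRow q (a 0) (a 2)).withTransportedTorus g g' hgg' hg'g hgΩ)) (p ^ M)) (γ₀ : GA ((PlaneData.mixedRow q (a 0) (a 2)).withTransportedTorus g g' hgg' hg'g hgΩ)) νf' b ∂νf‖)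
    (hdisp : ∀ finf : GA ((PlaneData.mixedRow q (a 0) (a 2)).withTransportedTorus g g' hgg' hg'g hgΩ) → ℂ,
      IsArchCoeffD _ (Setting.ofAdelicData _ R μ DG fdG compG compT compT') R q g g' w₀ eP eM eP' eM'
        (γ₀ : GA ((PlaneData.mixedRow q (a 0) (a 2)).withTransportedTorus g g' hgg' hg'g hgΩ)) νinf νinf' finf →
      ∃ e : GA ((PlaneData.mixedRow q (a 0) (a 2)).withTransportedTorus g g' hgg' hg'g hgΩ) → ℂ, IsInfFactor _ e ∧
        (∀ (w : InfinitePlace k) (κ : GA ((PlaneData.mixedRow q (a 0) (a 2)).withTransportedTorus g g' hgg' hg'g hgΩ)), κ ∈ localTorusAt' _ w → ∀ x,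
          e (x * κ) = weightAt' _ q w g g' 0 κ ^ (-eP' w) * weightAt' _ q w g g' 1 κ ^ (-eM' w) * e x) ∧
        L1Class.archFactor _ R (convInf _ μinf finf e) (γ₀ : GA ((PlaneData.mixedRow q (a 0) (a 2)).withTransportedTorus g g' hgg' hg'g hgΩ)) νinf νinf' ≠ 0 ∧
        (∃ gth : ℕ → ℝ, Tendsto gth atTop atTop ∧
          ∀ (M : ℕ) (γ : (Setting.ofAdelicData _ R μ DG fdG compG compT compT').Gk),
            (Setting.ofAdelicData _ R μ DG fdG compG compT compT').orbitOf γ ∉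
              ({(Setting.ofAdelicData _ R μ DG fdG compG compT compT').orbitOf γ₀} :
                Finset (Setting.ofAdelicData _ R μ DG fdG compG compT compT').Orbit) →
            (∃ t ∈ R.DT, ∃ t' ∈ R.DT',
              (Setting.ofAdelicData _ R μ DG fdG compG compT compT').conv
                (prodFn _ finf (ffinMu _ μ₀ (γ₀ : GA ((PlaneData.mixedRow q (a 0) (a 2)).withTransportedTorus g g' hgg' hg'g hgΩ)) (p ^ M))) (testNat _ e (p ^ M))
                ((t : GA ((PlaneData.mixedRow q (a 0) (a 2)).withTransportedTorus g g' hgg' hg'g hgΩ))⁻¹ * γ * (t' : GA ((PlaneData.mixedRow q (a 0) (a 2)).withTransportedTorus g g' hgg' hg'g hgΩ))) ≠ 0) →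
            gth (p ^ M) ≤ archDist _ (γ : GA ((PlaneData.mixedRow q (a 0) (a 2)).withTransportedTorus g g' hgg' hg'g hgΩ))) ∧
        ∀ M : ℕ, ChainInputs _ R γ₀ νinf νf νinf' νf' DZf
          ((Setting.ofAdelicData _ R μ DG fdG compG compT compT').conv
            (prodFn _ finf (ffinMu _ μ₀ (γ₀ : GA ((PlaneData.mixedRow q (a 0) (a 2)).withTransportedTorus g g' hgg' hg'g hgΩ)) (p ^ M))) (testNat _ e (p ^ M)))
          (fun x => (c₀ : ℂ) * convInf _ μinf finf e x) (levelDC _ (γ₀ : GA ((PlaneData.mixedRow q (a 0) (a 2)).withTransportedTorus g g' hgg' hg'g hgΩ)) (p ^ M))) :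
    ∀ finf : GA ((PlaneData.mixedRow q (a 0) (a 2)).withTransportedTorus g g' hgg' hg'g hgΩ) → ℂ,
      IsArchCoeffD _ (Setting.ofAdelicData _ R μ DG fdG compG compT compT') R q g g' w₀ eP eM eP' eM'
        (γ₀ : GA ((PlaneData.mixedRow q (a 0) (a 2)).withTransportedTorus g g' hgg' hg'g hgΩ)) νinf νinf' finf →
      ∃ lev : ℕ → ℕ, (∀ n, lev n ≠ 0) ∧
      ∃ ffin f₂ : ℕ → GA ((PlaneData.mixedRow q (a 0) (a 2)).withTransportedTorus g g' hgg' hg'g hgΩ) → ℂ,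
        TailFamily' _ q g g' eP' eM' (γ₀ : GA ((PlaneData.mixedRow q (a 0) (a 2)).withTransportedTorus g g' hgg' hg'g hgΩ)) ffin f₂ ∧
        ∃ E : Finset (Setting.ofAdelicData _ R μ DG fdG compG compT compT').Orbit,
          (Setting.ofAdelicData _ R μ DG fdG compG compT compT').orbitOf γ₀ ∈ E ∧
          FibreDominatedFrom (Setting.ofAdelicData _ R μ DG fdG compG compT compT') R.chi R.chi' E
            (fun n => (Setting.ofAdelicData _ R μ DG fdG compG compT compT').conv
              (prodFn _ finf (ffin (lev n))) (f₂ (lev n))) :=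
  tailForArch_body_of_pieces _ R μ DG fdG compG compT compT' hRH hc hu hc' hu' q g g' w₀ eP eM eP' eM' hdet
    (isGenuineRow_seesawPlane q ht hn a (ha 0) (ha 2) g g' hgg' hg'g hgΩ lam hlam hiso) γ₀ hlin νinf νf c hc0 hcμ
    νinf' νf' c' hc0' hcμ' DZf hDZf hfd hDZc μinf μ₀ c₀ hc₀ hcμ₀ p hp hγ₀ u κ hκ hproj M₃ hM₃ hcur hcount hnv hdisp


/-- **The seesaw assembly with the (F) pieces in THRESHOLD form** (crit-2 R1, S15873, closed at the instance): `hproj` and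
`hcur` only from the level `c₀` on; the finitely many lower levels are patched by `exists_pieces_of_threshold`. -/
theorem tailForArch_seesaw_of_pieces_threshold (q : QuadData k) (ht : q.t = 0) (hn : ¬ IsSquare (-q.n))
    (a : Fin 4 → k) (ha : ∀ i, a i ≠ 0)
    (g g' : Matrix (Fin 4) (Fin 4) k) (hgg' : g * g' = 1) (hg'g : g' * g = 1)
    (hgΩ : g * (PlaneData.mixedRow q (a 0) (a 2)).Ω = (PlaneData.mixedRow q (a 0) (a 2)).Ω * g)
    (lam : k) (hlam : lam ≠ 0)
    (hiso : g * (PlaneData.mixedRow q (a 1) (a 3)).B * gᵀ = lam • (PlaneData.mixedRow q (a 0) (a 2)).B)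
    (hdet : (((PlaneData.mixedRow q (a 0) (a 2)).withTransportedTorus g g' hgg' hg'g hgΩ)).B.det ≠ 0)
    [MeasurableSpace (GA ((PlaneData.mixedRow q (a 0) (a 2)).withTransportedTorus g g' hgg' hg'g hgΩ))] [BorelSpace (GA ((PlaneData.mixedRow q (a 0) (a 2)).withTransportedTorus g g' hgg' hg'g hgΩ))] [MeasurableMul (torusT ((PlaneData.mixedRow q (a 0) (a 2)).withTransportedTorus g g' hgg' hg'g hgΩ))] [MeasurableMul (torusT' ((PlaneData.mixedRow q (a 0) (a 2)).withTransportedTorus g g' hgg' hg'g hgΩ))]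
    (R : RTFData ((PlaneData.mixedRow q (a 0) (a 2)).withTransportedTorus g g' hgg' hg'g hgΩ)) (hRH : R.IsHaar)
    (hc : Continuous R.chi) (hu : ∀ a, ‖R.chi a‖ = 1) (hc' : Continuous R.chi') (hu' : ∀ a, ‖R.chi' a‖ = 1)
    (w₀ : InfinitePlace k) (eP eM eP' eM' : InfinitePlace k → ℤ)
    [R.μT.IsHaarMeasure] [R.μT'.IsHaarMeasure]
    (μ : Measure (GA ((PlaneData.mixedRow q (a 0) (a 2)).withTransportedTorus g g' hgg' hg'g hgΩ))) [μ.IsHaarMeasure] (DG : Set (GA ((PlaneData.mixedRow q (a 0) (a 2)).withTransportedTorus g g' hgg' hg'g hgΩ))) (fdG : IsFundamentalDomain (rationalPoints ((PlaneData.mixedRow q (a 0) (a 2)).withTransportedTorus g g' hgg' hg'g hgΩ)) DG μ)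
    (compG : IsCompact (closure DG)) (compT : IsCompact (closure R.DT)) (compT' : IsCompact (closure R.DT'))
    (γ₀ : rationalPoints ((PlaneData.mixedRow q (a 0) (a 2)).withTransportedTorus g g' hgg' hg'g hgΩ)) (hlin : IsLinRegular ((PlaneData.mixedRow q (a 0) (a 2)).withTransportedTorus g g' hgg' hg'g hgΩ) γ₀)
    (νinf : Measure (torusInf ((PlaneData.mixedRow q (a 0) (a 2)).withTransportedTorus g g' hgg' hg'g hgΩ))) [νinf.IsHaarMeasure] [CompactSpace (torusInf ((PlaneData.mixedRow q (a 0) (a 2)).withTransportedTorus g g' hgg' hg'g hgΩ))]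
    (νf : Measure (torusFin ((PlaneData.mixedRow q (a 0) (a 2)).withTransportedTorus g g' hgg' hg'g hgΩ))) [νf.IsHaarMeasure]
    (c : ℝ≥0) (hc0 : 0 < c) (hcμ : R.μT = c • Measure.map (torusSplit ((PlaneData.mixedRow q (a 0) (a 2)).withTransportedTorus g g' hgg' hg'g hgΩ)).symm (νinf.prod νf))
    (νinf' : Measure (torusInf' ((PlaneData.mixedRow q (a 0) (a 2)).withTransportedTorus g g' hgg' hg'g hgΩ))) [νinf'.IsHaarMeasure] [CompactSpace (torusInf' ((PlaneData.mixedRow q (a 0) (a 2)).withTransportedTorus g g' hgg' hg'g hgΩ))]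
    (νf' : Measure (torusFin' ((PlaneData.mixedRow q (a 0) (a 2)).withTransportedTorus g g' hgg' hg'g hgΩ))) [νf'.IsHaarMeasure]
    (c' : ℝ≥0) (hc0' : 0 < c') (hcμ' : R.μT' = c' • Measure.map (torusSplit' ((PlaneData.mixedRow q (a 0) (a 2)).withTransportedTorus g g' hgg' hg'g hgΩ)).symm (νinf'.prod νf'))
    (DZf : Set (torusFin ((PlaneData.mixedRow q (a 0) (a 2)).withTransportedTorus g g' hgg' hg'g hgΩ))) (hDZf : MeasurableSet DZf) (hfd : IsFundamentalDomain (centreFin ((PlaneData.mixedRow q (a 0) (a 2)).withTransportedTorus g g' hgg' hg'g hgΩ)) DZf νf)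
    (hDZc : ∀ C : Set (torusFin ((PlaneData.mixedRow q (a 0) (a 2)).withTransportedTorus g g' hgg' hg'g hgΩ)), IsCompact C → IsCompact (closure (DZf ∩ (C * (ZfIn ((PlaneData.mixedRow q (a 0) (a 2)).withTransportedTorus g g' hgg' hg'g hgΩ) : Set (torusFin ((PlaneData.mixedRow q (a 0) (a 2)).withTransportedTorus g g' hgg' hg'g hgΩ)))))))
    (μinf : Measure (infinitePart ((PlaneData.mixedRow q (a 0) (a 2)).withTransportedTorus g g' hgg' hg'g hgΩ))) [μinf.IsHaarMeasure] (μ₀ : Measure (finitePart ((PlaneData.mixedRow q (a 0) (a 2)).withTransportedTorus g g' hgg' hg'g hgΩ))) [μ₀.IsHaarMeasure]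
    (c₀' : ℝ≥0) (hc₀' : 0 < c₀') (hcμ₀ : μ = c₀' • Measure.map (gaSplit ((PlaneData.mixedRow q (a 0) (a 2)).withTransportedTorus g g' hgg' hg'g hgΩ)).symm (μinf.prod μ₀))
    (p : ℕ) (hp : p.Prime)
    (hγ₀ : ∀ v : HeightOneSpectrum (𝓞 k), natSize k v p < 1 → ∀ i j : Fin 4,
      Valued.v (finPart k (GA.mat ((PlaneData.mixedRow q (a 0) (a 2)).withTransportedTorus g g' hgg' hg'g hgΩ) (γ₀ : GA ((PlaneData.mixedRow q (a 0) (a 2)).withTransportedTorus g g' hgg' hg'g hgΩ)) i j) v) ≤ 1 ∧ Valued.v (finPart k (GA.mat ((PlaneData.mixedRow q (a 0) (a 2)).withTransportedTorus g g' hgg' hg'g hgΩ) (γ₀ : GA ((PlaneData.mixedRow q (a 0) (a 2)).withTransportedTorus g g' hgg' hg'g hgΩ))⁻¹ i j) v) ≤ 1)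
    -- the (F) pieces in threshold form
    (c₀ : ℕ) (u : ℕ → ℝ≥0∞) (κ : ℝ≥0∞) (hκ : κ ≠ ⊤)
    (hproj : ∀ M, c₀ ≤ M → ∀ γ : GA ((PlaneData.mixedRow q (a 0) (a 2)).withTransportedTorus g g' hgg' hg'g hgΩ), νf (finTf ((PlaneData.mixedRow q (a 0) (a 2)).withTransportedTorus g g' hgg' hg'g hgΩ) '' closure R.DT ∩ projSet ((PlaneData.mixedRow q (a 0) (a 2)).withTransportedTorus g g' hgg' hg'g hgΩ) (γ₀ : GA ((PlaneData.mixedRow q (a 0) (a 2)).withTransportedTorus g g' hgg' hg'g hgΩ)) (p ^ M) γ) ≤ κ * u M)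
    (M₃ : ℝ≥0∞) (hM₃ : M₃ ≠ ⊤)
    (hcur : ∀ M, c₀ ≤ M → u M ≤ M₃ * νf (((ZfIn ((PlaneData.mixedRow q (a 0) (a 2)).withTransportedTorus g g' hgg' hg'g hgΩ) : Set (torusFin ((PlaneData.mixedRow q (a 0) (a 2)).withTransportedTorus g g' hgg' hg'g hgΩ))) ∩ levelTf ((PlaneData.mixedRow q (a 0) (a 2)).withTransportedTorus g g' hgg' hg'g hgΩ) 1) * levelTf ((PlaneData.mixedRow q (a 0) (a 2)).withTransportedTorus g g' hgg' hg'g hgΩ) (p ^ M)))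
    (hcount : SublevelCount₀ ((PlaneData.mixedRow q (a 0) (a 2)).withTransportedTorus g g' hgg' hg'g hgΩ) (Setting.ofAdelicData ((PlaneData.mixedRow q (a 0) (a 2)).withTransportedTorus g g' hgg' hg'g hgΩ) R μ DG fdG compG compT compT'))
    (hnv : ∃ δ : ℝ, 0 < δ ∧ ∃ M₀ : ℕ, ∀ M ≥ M₀,
      δ * (suppMeasure ((PlaneData.mixedRow q (a 0) (a 2)).withTransportedTorus g g' hgg' hg'g hgΩ) νf νf' (γ₀ : GA ((PlaneData.mixedRow q (a 0) (a 2)).withTransportedTorus g g' hgg' hg'g hgΩ)) DZf (p ^ M) (γ₀ : GA ((PlaneData.mixedRow q (a 0) (a 2)).withTransportedTorus g g' hgg' hg'g hgΩ))).toReal ≤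
        ‖∫ b in DZf, R.chi b * innerFin ((PlaneData.mixedRow q (a 0) (a 2)).withTransportedTorus g g' hgg' hg'g hgΩ) R (levelDC ((PlaneData.mixedRow q (a 0) (a 2)).withTransportedTorus g g' hgg' hg'g hgΩ) (γ₀ : GA ((PlaneData.mixedRow q (a 0) (a 2)).withTransportedTorus g g' hgg' hg'g hgΩ)) (p ^ M)) (γ₀ : GA ((PlaneData.mixedRow q (a 0) (a 2)).withTransportedTorus g g' hgg' hg'g hgΩ)) νf' b ∂νf‖)
    (hdisp : ∀ finf : GA ((PlaneData.mixedRow q (a 0) (a 2)).withTransportedTorus g g' hgg' hg'g hgΩ) → ℂ,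
      IsArchCoeffD ((PlaneData.mixedRow q (a 0) (a 2)).withTransportedTorus g g' hgg' hg'g hgΩ) (Setting.ofAdelicData ((PlaneData.mixedRow q (a 0) (a 2)).withTransportedTorus g g' hgg' hg'g hgΩ) R μ DG fdG compG compT compT') R q g g' w₀ eP eM eP' eM'
        (γ₀ : GA ((PlaneData.mixedRow q (a 0) (a 2)).withTransportedTorus g g' hgg' hg'g hgΩ)) νinf νinf' finf →
      ∃ e : GA ((PlaneData.mixedRow q (a 0) (a 2)).withTransportedTorus g g' hgg' hg'g hgΩ) → ℂ, IsInfFactor ((PlaneData.mixedRow q (a 0) (a 2)).withTransportedTorus g g' hgg' hg'g hgΩ) e ∧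
        (∀ (w : InfinitePlace k) (κ : GA ((PlaneData.mixedRow q (a 0) (a 2)).withTransportedTorus g g' hgg' hg'g hgΩ)), κ ∈ localTorusAt' ((PlaneData.mixedRow q (a 0) (a 2)).withTransportedTorus g g' hgg' hg'g hgΩ) w → ∀ x,
          e (x * κ) = weightAt' ((PlaneData.mixedRow q (a 0) (a 2)).withTransportedTorus g g' hgg' hg'g hgΩ) q w g g' 0 κ ^ (-eP' w) * weightAt' ((PlaneData.mixedRow q (a 0) (a 2)).withTransportedTorus g g' hgg' hg'g hgΩ) q w g g' 1 κ ^ (-eM' w) * e x) ∧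
        L1Class.archFactor ((PlaneData.mixedRow q (a 0) (a 2)).withTransportedTorus g g' hgg' hg'g hgΩ) R (convInf ((PlaneData.mixedRow q (a 0) (a 2)).withTransportedTorus g g' hgg' hg'g hgΩ) μinf finf e) (γ₀ : GA ((PlaneData.mixedRow q (a 0) (a 2)).withTransportedTorus g g' hgg' hg'g hgΩ)) νinf νinf' ≠ 0 ∧
        (∃ gth : ℕ → ℝ, Tendsto gth atTop atTop ∧
          ∀ (M : ℕ) (γ : (Setting.ofAdelicData ((PlaneData.mixedRow q (a 0) (a 2)).withTransportedTorus g g' hgg' hg'g hgΩ) R μ DG fdG compG compT compT').Gk),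
            (Setting.ofAdelicData ((PlaneData.mixedRow q (a 0) (a 2)).withTransportedTorus g g' hgg' hg'g hgΩ) R μ DG fdG compG compT compT').orbitOf γ ∉
              ({(Setting.ofAdelicData ((PlaneData.mixedRow q (a 0) (a 2)).withTransportedTorus g g' hgg' hg'g hgΩ) R μ DG fdG compG compT compT').orbitOf γ₀} :
                Finset (Setting.ofAdelicData ((PlaneData.mixedRow q (a 0) (a 2)).withTransportedTorus g g' hgg' hg'g hgΩ) R μ DG fdG compG compT compT').Orbit) →
            (∃ t ∈ R.DT, ∃ t' ∈ R.DT',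
              (Setting.ofAdelicData ((PlaneData.mixedRow q (a 0) (a 2)).withTransportedTorus g g' hgg' hg'g hgΩ) R μ DG fdG compG compT compT').conv
                (prodFn ((PlaneData.mixedRow q (a 0) (a 2)).withTransportedTorus g g' hgg' hg'g hgΩ) finf (ffinMu ((PlaneData.mixedRow q (a 0) (a 2)).withTransportedTorus g g' hgg' hg'g hgΩ) μ₀ (γ₀ : GA ((PlaneData.mixedRow q (a 0) (a 2)).withTransportedTorus g g' hgg' hg'g hgΩ)) (p ^ M))) (testNat ((PlaneData.mixedRow q (a 0) (a 2)).withTransportedTorus g g' hgg' hg'g hgΩ) e (p ^ M))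
                ((t : GA ((PlaneData.mixedRow q (a 0) (a 2)).withTransportedTorus g g' hgg' hg'g hgΩ))⁻¹ * γ * (t' : GA ((PlaneData.mixedRow q (a 0) (a 2)).withTransportedTorus g g' hgg' hg'g hgΩ))) ≠ 0) →
            gth (p ^ M) ≤ archDist ((PlaneData.mixedRow q (a 0) (a 2)).withTransportedTorus g g' hgg' hg'g hgΩ) (γ : GA ((PlaneData.mixedRow q (a 0) (a 2)).withTransportedTorus g g' hgg' hg'g hgΩ))) ∧
        ∀ M : ℕ, ChainInputs ((PlaneData.mixedRow q (a 0) (a 2)).withTransportedTorus g g' hgg' hg'g hgΩ) R γ₀ νinf νf νinf' νf' DZf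
          ((Setting.ofAdelicData ((PlaneData.mixedRow q (a 0) (a 2)).withTransportedTorus g g' hgg' hg'g hgΩ) R μ DG fdG compG compT compT').conv
            (prodFn ((PlaneData.mixedRow q (a 0) (a 2)).withTransportedTorus g g' hgg' hg'g hgΩ) finf (ffinMu ((PlaneData.mixedRow q (a 0) (a 2)).withTransportedTorus g g' hgg' hg'g hgΩ) μ₀ (γ₀ : GA ((PlaneData.mixedRow q (a 0) (a 2)).withTransportedTorus g g' hgg' hg'g hgΩ)) (p ^ M))) (testNat ((PlaneData.mixedRow q (a 0) (a 2)).withTransportedTorus g g' hgg' hg'g hgΩ) e (p ^ M)))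
          (fun x => (c₀' : ℂ) * convInf ((PlaneData.mixedRow q (a 0) (a 2)).withTransportedTorus g g' hgg' hg'g hgΩ) μinf finf e x) (levelDC ((PlaneData.mixedRow q (a 0) (a 2)).withTransportedTorus g g' hgg' hg'g hgΩ) (γ₀ : GA ((PlaneData.mixedRow q (a 0) (a 2)).withTransportedTorus g g' hgg' hg'g hgΩ)) (p ^ M))) :
    ∀ finf : GA ((PlaneData.mixedRow q (a 0) (a 2)).withTransportedTorus g g' hgg' hg'g hgΩ) → ℂ,
      IsArchCoeffD ((PlaneData.mixedRow q (a 0) (a 2)).withTransportedTorus g g' hgg' hg'g hgΩ) (Setting.ofAdelicData ((PlaneData.mixedRow q (a 0) (a 2)).withTransportedTorus g g' hgg' hg'g hgΩ) R μ DG fdG compG compT compT') R q g g' w₀ eP eM eP' eM'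
        (γ₀ : GA ((PlaneData.mixedRow q (a 0) (a 2)).withTransportedTorus g g' hgg' hg'g hgΩ)) νinf νinf' finf →
      ∃ lev : ℕ → ℕ, (∀ n, lev n ≠ 0) ∧
      ∃ ffin f₂ : ℕ → GA ((PlaneData.mixedRow q (a 0) (a 2)).withTransportedTorus g g' hgg' hg'g hgΩ) → ℂ, TailFamily' ((PlaneData.mixedRow q (a 0) (a 2)).withTransportedTorus g g' hgg' hg'g hgΩ) q g g' eP' eM' (γ₀ : GA ((PlaneData.mixedRow q (a 0) (a 2)).withTransportedTorus g g' hgg' hg'g hgΩ)) ffin f₂ ∧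
        ∃ E : Finset (Setting.ofAdelicData ((PlaneData.mixedRow q (a 0) (a 2)).withTransportedTorus g g' hgg' hg'g hgΩ) R μ DG fdG compG compT compT').Orbit,
          (Setting.ofAdelicData ((PlaneData.mixedRow q (a 0) (a 2)).withTransportedTorus g g' hgg' hg'g hgΩ) R μ DG fdG compG compT compT').orbitOf γ₀ ∈ E ∧
          FibreDominatedFrom (Setting.ofAdelicData ((PlaneData.mixedRow q (a 0) (a 2)).withTransportedTorus g g' hgg' hg'g hgΩ) R μ DG fdG compG compT compT') R.chi R.chi' E
            (fun n => (Setting.ofAdelicData ((PlaneData.mixedRow q (a 0) (a 2)).withTransportedTorus g g' hgg' hg'g hgΩ) R μ DG fdG compG compT compT').conv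
              (prodFn ((PlaneData.mixedRow q (a 0) (a 2)).withTransportedTorus g g' hgg' hg'g hgΩ) finf (ffin (lev n))) (f₂ (lev n))) := by
  obtain ⟨u', κ', M₃', hκ', hM₃', hproj', hcur'⟩ :=
    exists_pieces_of_threshold ((PlaneData.mixedRow q (a 0) (a 2)).withTransportedTorus g g' hgg' hg'g hgΩ) R compT νf (γ₀ : GA ((PlaneData.mixedRow q (a 0) (a 2)).withTransportedTorus g g' hgg' hg'g hgΩ)) p hp.ne_zero c₀ u κ hκ hproj M₃ hM₃ hcur
  exact tailForArch_seesaw_of_pieces q ht hn a ha g g' hgg' hg'g hgΩ lam hlam hiso hdet R hRH hc hu hc' hu' w₀ eP eM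
    eP' eM' μ DG fdG compG compT compT' γ₀ hlin νinf νf c hc0 hcμ νinf' νf' c' hc0' hcμ' DZf hDZf hfd hDZc μinf μ₀
    c₀' hc₀' hcμ₀ p hp hγ₀ u' κ' hκ' hproj' M₃' hM₃' hcur' hcount hnv hdisp

end Seesaw

end Summit.Ventures.HodgeRepro.Tier4.Line4

end
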